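import Mathlib
import Summits.ValiantsHypothesis.ValiantsHypothesis.Theorems.FifoMatchingNNNotVPDivisionSplitDefs
import Literature.Computability.AlgebraicComplexity.SparseCircuitBounds
import Literature.Computability.AlgebraicComplexity.NestFreeMatchingPoly
import HarnessLib

/-!
# Route FifoMatching — crux `NNNotVP` (stmt-ValiantsHypothesis-11615), line `division_split`:
# stub B2 `stub_spreadCofactorReduction` FOLLOWS FROM exponential division hardness of `NN`

The registered stub B2 of line `division_split` (verbatim, in the line's vocabulary `σ` / `NN` of
`Theorems/FifoMatchingNNNotVPDivisionSplitDefs.lean`):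

  `∃ k, ∀ n h, h ≠ 0 → ∃ h', (∃ m ∈ supp h', |supp m| ≤ (log₂ n + k)^k) ∧
      L₊(NN_n · h') ≤ 2^((log₂ n + log₂ (L₊(NN_n · h) + L₊(h)) + k)^k)`.

The tree knows B2 ⟹ `NNDivisionHard` (quasi-polynomial division hardness, stmt-21181;
`AfterStubA.nnDivisionHard_of_spreadCofactorReduction`, ✓ p821952).  This file proves the other side
of the sandwich: **EXPONENTIAL division hardness of `NN` ⟹ B2** (`spreadCofactorReduction_of_expDivisionHard`),
where exponential division hardness is spelled out inline as

  `∃ r n₀, ∀ n ≥ n₀, ∀ h ≠ 0, n ≤ (log₂ (L₊(NN_n · h) + L₊(h)))^r`   (i.e. `L₊(NN_n·h) + L₊(h) ≥ 2^{n^{1/r}}`).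

Proof: the FREE cofactor `h' := 1` (its monomial `x^0` has empty support) needs only
`L₊(NN_n) ≤ 2^((log₂ n + log₂ cert + k)^k)`; the trivial bound `L₊(NN_n) ≤ 2^(4n³ + n + 1)`
(`complexity_NN_le`, from `complexity_le_card_support_mul` / `card_support_le_pow`: degree `≤ n`,
`4n²` variables) is absorbed as soon as `log₂ cert ≥ n^{1/r}`, with `k := max (3r + 14) (4n₀³ + n₀ + 2)`
covering the finitely many small levels.

So, BY NAME: `ExpDivisionHard(NN) ⟹ B2 ⟹ NNDivisionHard` — the registered stub B2 sits between the
exponential and the quasi-polynomial division hardness of `NN`; it is of EXPONENTIAL TYPE (g4's census,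
now a theorem on one side).  Honest framing: classification of an OPEN stub between two OPEN statements;
nothing here is progress on any of them or on `VP ≠ VNP`.  No definitions, no named facts.
-/

noncomputable section

-- Sub = Summit single-conjunct layout: the duplicated namespace component is mandated by the tree.
set_option linter.dupNamespace false
set_option autoImplicit false

namespace Summit.ValiantsHypothesis.ValiantsHypothesis.Theorems.FifoMatching.NNNotVP.SpreadCofactorExpType

open MvPolynomial Finset Literature.Computability.AlgebraicComplexity
open scoped NNReal BigOperators Classical
open Summit.ValiantsHypothesis.ValiantsHypothesis.Theorems.FifoMatching.NNNotVP.DivisionSplit (σ NN)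

/-! ### §1 The trivial exponential upper bound for `NN_n` -/

/-- **`L₊(NN_n) ≤ 2^(4n³ + n + 1)`**: `NN_n` has degree `≤ n` in `4n²` variables, hence at most
`(n+1)^{4n²} ≤ 2^{4n³}` monomials, each of cost `≤ 2n + 1` (`complexity_le_card_support_mul`,
`card_support_le_pow`). [folklore] -/
theorem complexity_NN_le (n : ℕ) : complexity (NN n) ≤ 2 ^ (4 * n ^ 3 + n + 1) := by
  have hD : (NN n).totalDegree ≤ n := totalDegree_nestFreeMatchingPoly_le n (k := ℝ≥0)
  have hV : Fintype.card (σ n) = 2 * n * (2 * n) := by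
    simp [σ, Fintype.card_prod, Fintype.card_fin]
  have h1 := complexity_le_card_support_mul (NN n)
  have h2 := card_support_le_pow (NN n)
  rw [hV] at h2
  have hn2 : n < 2 ^ n := Nat.lt_two_pow_self
  have h3 : ((NN n).totalDegree + 1) ^ (2 * n * (2 * n)) ≤ (2 ^ n) ^ (2 * n * (2 * n)) :=
    Nat.pow_le_pow_left (by omega) _
  have h4 : 2 * (NN n).totalDegree + 2 ≤ 2 ^ (n + 1) := by
    rw [pow_succ]
    omega
  calc complexity (NN n) ≤ (NN n).support.card * (2 * (NN n).totalDegree + 2) := h1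
    _ ≤ (2 ^ n) ^ (2 * n * (2 * n)) * 2 ^ (n + 1) := Nat.mul_le_mul (h2.trans h3) h4
    _ = 2 ^ (4 * n ^ 3 + n + 1) := by
        rw [← pow_mul, ← pow_add]
        congr 1
        ring

/-! ### §2 Arithmetic of the absorption -/

/-- `4n³ + n + 1 ≤ 14 n³` for `n ≥ 1`. [folklore] -/
theorem exp_bound_le (n : ℕ) (hn : 1 ≤ n) : 4 * n ^ 3 + n + 1 ≤ 14 * n ^ 3 := by
  have h3 : n ≤ n ^ 3 := by
    calc n = n ^ 1 := (pow_one n).symm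
      _ ≤ n ^ 3 := Nat.pow_le_pow_right hn (by norm_num)
  have h1 : 1 ≤ n ^ 3 := Nat.one_le_pow _ _ hn
  omega

/-- The absorption inequality: if `n ≤ b^r`, `k ≥ 3r + 14`, then `14 n³ ≤ (b + k)^k`. [folklore] -/
theorem absorb (n b r k : ℕ) (hnb : n ≤ b ^ r) (hk : 3 * r + 14 ≤ k) :
    14 * n ^ 3 ≤ (b + k) ^ k := by
  have hbk : 1 ≤ b + k := by omega
  -- `n³ ≤ (b+k)^(3r)`
  have h1 : n ^ 3 ≤ (b + k) ^ (3 * r) := by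
    calc n ^ 3 ≤ (b ^ r) ^ 3 := Nat.pow_le_pow_left hnb 3
      _ = b ^ (3 * r) := by rw [← pow_mul]; ring_nf
      _ ≤ (b + k) ^ (3 * r) := Nat.pow_le_pow_left (Nat.le_add_right b k) _
  -- `14 ≤ (b+k)^(k - 3r)` since `k - 3r ≥ 14 ≥ 1` and `b + k ≥ 14`
  have h2 : 14 ≤ (b + k) ^ (k - 3 * r) := by
    calc 14 ≤ b + k := by omega
      _ = (b + k) ^ 1 := (pow_one _).symm
      _ ≤ (b + k) ^ (k - 3 * r) := Nat.pow_le_pow_right hbk (by omega)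
  calc 14 * n ^ 3 ≤ (b + k) ^ (k - 3 * r) * (b + k) ^ (3 * r) := Nat.mul_le_mul h2 h1
    _ = (b + k) ^ k := by rw [← pow_add]; congr 1; omega

/-! ### §3 Exponential division hardness implies B2 -/

/-- ★ **`ExpDivisionHard(NN) ⟹ B2`** (`stub_spreadCofactorReduction` of line `division_split`, verbatim
conclusion): if for some `r`, eventually in `n`, every nonzero cofactor `h` has
`n ≤ (log₂ (L₊(NN_n · h) + L₊(h)))^r`, then the spread-cofactor reduction holds — with the free
cofactor `h' := 1`. [folklore] -/
theorem spreadCofactorReduction_of_expDivisionHard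
    (hE : ∃ r n₀ : ℕ, ∀ n ≥ n₀, ∀ h : MvPolynomial (σ n) ℝ≥0, h ≠ 0 →
      n ≤ (Nat.log 2 (complexity (NN n * h) + complexity h)) ^ r) :
    ∃ k : ℕ, ∀ (n : ℕ) (h : MvPolynomial (σ n) ℝ≥0), h ≠ 0 →
      ∃ h' : MvPolynomial (σ n) ℝ≥0, (∃ m ∈ h'.support, m.support.card ≤ (Nat.log 2 n + k) ^ k) ∧
        complexity (NN n * h') ≤
          2 ^ ((Nat.log 2 n + Nat.log 2 (complexity (NN n * h) + complexity h) + k) ^ k) := by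
  obtain ⟨r, n₀, hr⟩ := hE
  refine ⟨max (3 * r + 14) (4 * n₀ ^ 3 + n₀ + 2), fun n h hh => ⟨1, ⟨0, ?_, by simp⟩, ?_⟩⟩
  · -- the empty monomial of `h' = 1`
    rw [MvPolynomial.mem_support_iff, MvPolynomial.coeff_one, if_pos rfl]
    exact one_ne_zero
  · set k : ℕ := max (3 * r + 14) (4 * n₀ ^ 3 + n₀ + 2) with hk
    set b : ℕ := Nat.log 2 (complexity (NN n * h) + complexity h) with hb
    rw [mul_one]
    refine (complexity_NN_le n).trans (Nat.pow_le_pow_right (by norm_num) ?_)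
    have hk1 : 3 * r + 14 ≤ k := le_max_left _ _
    have hk2 : 4 * n₀ ^ 3 + n₀ + 2 ≤ k := le_max_right _ _
    have hmono : (b + k) ^ k ≤ (Nat.log 2 n + b + k) ^ k :=
      Nat.pow_le_pow_left (by omega) k
    by_cases hn : n₀ ≤ n
    · -- large level: exponential hardness of the given certificate absorbs the trivial bound
      have hn1 : 1 ≤ n ∨ n = 0 := by omega
      rcases hn1 with hn1 | hn0
      · have hnb : n ≤ b ^ r := hr n hn h hh
        calc 4 * n ^ 3 + n + 1 ≤ 14 * n ^ 3 := exp_bound_le n hn1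
          _ ≤ (b + k) ^ k := absorb n b r k hnb hk1
          _ ≤ (Nat.log 2 n + b + k) ^ k := hmono
      · subst hn0
        have hkk : k ≤ (b + k) ^ k := by
          calc k ≤ b + k := Nat.le_add_left k b
            _ = (b + k) ^ 1 := (pow_one _).symm
            _ ≤ (b + k) ^ k := Nat.pow_le_pow_right (by omega) (by omega)
        calc 4 * 0 ^ 3 + 0 + 1 ≤ k := by omega
          _ ≤ (b + k) ^ k := hkk
          _ ≤ (Nat.log 2 0 + b + k) ^ k := hmono
    · -- small level `n < n₀`: the constant `k ≥ 4n₀³ + n₀ + 2` absorbs everything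
      have hlt : n ≤ n₀ := by omega
      have hpoly : 4 * n ^ 3 + n + 1 ≤ 4 * n₀ ^ 3 + n₀ + 1 := by
        have : n ^ 3 ≤ n₀ ^ 3 := Nat.pow_le_pow_left hlt 3
        omega
      have hkk : k ≤ (b + k) ^ k := by
        calc k ≤ b + k := Nat.le_add_left k b
          _ = (b + k) ^ 1 := (pow_one _).symm
          _ ≤ (b + k) ^ k := Nat.pow_le_pow_right (by omega) (by omega)
      calc 4 * n ^ 3 + n + 1 ≤ 4 * n₀ ^ 3 + n₀ + 1 := hpoly
        _ ≤ k := by omega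
        _ ≤ (b + k) ^ k := hkk
        _ ≤ (Nat.log 2 n + b + k) ^ k := hmono

end Summit.ValiantsHypothesis.ValiantsHypothesis.Theorems.FifoMatching.NNNotVP.SpreadCofactorExpType

end
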